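import Summits.RiemannHypothesis.RiemannHypothesis.Theorems.SuzukiKernelSemigroup

/-!
# Window factorisation `𝖪_{θ₁+θ₂}[t] = 𝖵_{θ₁}[t] ∘ 𝖪_{θ₂}[t]` of Suzuki's truncated Hankel operators (column DBR; RH-FREE)

RH-FREE throughout; nothing here bears on the truth of RH.

Card A of the cell rh-dbr's ideation (`theta-semigroup-clean-radius`, typed target `WindowFactorisation`,
HOME/rh-dbr-idea-1/Sketch.lean), the structural dividend of the convolution semigroup
`K_{θ₁+θ₂} = K_{θ₁} ∗ K_{θ₂}` (`Theorems.SuzukiKernelSemigroup.limKernel_add_eq_integral`): on the window `(−t, t)`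
the truncated Hankel operator `𝖪_θ[t] f (x) = ∫_{−t}^{t} K_θ(x + y) f(y) dy` factors through the CAUSAL (Volterra)
truncated convolution `𝖵_θ[t] g (x) = ∫_{−t}^{x} K_θ(x − v) g(v) dv`:

* `limKernel_add_shift_eq_setIntegral` — for `θ₁, θ₂ > 1`, `t > 0`, `x` real and `y < t`:
  `K_{θ₁+θ₂}(x + y) = ∫_{(−t, x)} K_{θ₁}(x − v) K_{θ₂}(v + y) dv` (semigroup + translation invariance + support in
  `[0, ∞)`);
* `window_factorisation` (the typed shape) — for `f ∈ L²(−t,t)` and `x ∈ (−t, t)`: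
  `∫_{(−t,t)} K_{θ₁+θ₂}(x + y) f(y) dy = ∫_{(−t,x)} K_{θ₁}(x − v) (∫_{(−t,t)} K_{θ₂}(v + y) f(y) dy) dv` (Fubini on a
  bounded continuous kernel against an `L¹` function).

An RH-free transfer rule for window certificates across `θ` at fixed `t`.  References: [Su20] M. Suzuki, ASPM 84
(2020) = arXiv:1907.07302, (1.4), (1.9), Thm 1.2.
-/

noncomputable section

-- D-0017: `Summit.<S>.<S>.…` is the designed namespace of a single-problem summit.
set_option linter.dupNamespace false

open Complex MeasureTheory Filter Topology Set

namespace Summit.RiemannHypothesis.RiemannHypothesis.Theorems.SuzukiKernelSemigroup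

open Literature.NumberTheory.LFunctions

/-! ## §1 The shifted semigroup law on the causal window -/

/-- RH-FREE.  `K_θ(x) = 0` for `x ≤ 0` (`θ > 1`). -/
theorem limKernel_eq_zero_of_nonpos {θ : ℝ} (hθ : 1 < θ) {x : ℝ} (hx : x ≤ 0) : limKernel θ x = 0 := by
  rcases eq_or_lt_of_le hx with rfl | hx'
  · exact limKernel_zero hθ
  · exact Suzuki2020_thm12_Kiii hθ hx'

/-- RH-FREE.  The semigroup law in the shifted variables: for `θ₁, θ₂ > 1` and all real `x, y`,
`K_{θ₁+θ₂}(x + y) = ∫_ℝ K_{θ₁}(x − v) K_{θ₂}(v + y) dv` (substitute `s = x − v` in `K_{θ₁} ∗ K_{θ₂}`). -/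
theorem limKernel_add_shift_eq_integral {θ₁ θ₂ : ℝ} (h₁ : 1 < θ₁) (h₂ : 1 < θ₂) (x y : ℝ) :
    limKernel (θ₁ + θ₂) (x + y) = ∫ v : ℝ, limKernel θ₁ (x - v) * limKernel θ₂ (v + y) := by
  rw [limKernel_add_eq_integral h₁ h₂ (x + y)]
  have h := integral_sub_left_eq_self (fun s : ℝ => limKernel θ₁ s * limKernel θ₂ (x + y - s)) volume x
  rw [← h]
  congr 1
  funext v
  congr 2
  ring

/-- RH-FREE.  On the causal window: for `θ₁, θ₂ > 1`, real `x` and `y < t`,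
`K_{θ₁+θ₂}(x + y) = ∫_{(−t, x)} K_{θ₁}(x − v) K_{θ₂}(v + y) dv` — outside `(−t, x)` the integrand vanishes
(`v ≥ x`: `K_{θ₁}(x − v) = 0`; `v ≤ −t`: `v + y < 0`, `K_{θ₂}(v + y) = 0`). -/
theorem limKernel_add_shift_eq_setIntegral {θ₁ θ₂ : ℝ} (h₁ : 1 < θ₁) (h₂ : 1 < θ₂) {t y : ℝ} (hy : y < t)
    (x : ℝ) :
    limKernel (θ₁ + θ₂) (x + y) = ∫ v in Ioo (-t) x, limKernel θ₁ (x - v) * limKernel θ₂ (v + y) := by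
  rw [limKernel_add_shift_eq_integral h₁ h₂, setIntegral_eq_integral_of_forall_compl_eq_zero]
  intro v hv
  simp only [mem_Ioo, not_and_or, not_lt] at hv
  rcases hv with hv | hv
  · rw [limKernel_eq_zero_of_nonpos h₂ (by linarith), mul_zero]
  · rw [limKernel_eq_zero_of_nonpos h₁ (by linarith), zero_mul]

/-! ## §2 Fubini: the window factorisation -/

/-- RH-FREE.  A continuous kernel is bounded on a compact square: `|K_θ(u)| ≤ C` for `|u| ≤ R` (`θ > 1`). -/
theorem exists_bound_limKernel {θ : ℝ} (hθ : 1 < θ) (R : ℝ) :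
    ∃ C : ℝ, 0 ≤ C ∧ ∀ u : ℝ, |u| ≤ R → |limKernel θ u| ≤ C := by
  have hc := (Suzuki2020_thm12_continuous hθ).continuousOn (s := Icc (-R) R)
  obtain ⟨C, hC⟩ := (isCompact_Icc.image_of_continuousOn hc).isBounded.exists_norm_le
  refine ⟨max C 0, le_max_right _ _, fun u hu => ?_⟩
  have hmem : limKernel θ u ∈ limKernel θ '' Icc (-R) R := ⟨u, abs_le.1 hu, rfl⟩
  exact ((Real.norm_eq_abs _).symm.le.trans (hC _ hmem)).trans (le_max_left _ _)

/-- **RH-FREE · WINDOW FACTORISATION** `𝖪_{θ₁+θ₂}[t] = 𝖵_{θ₁}[t] ∘ 𝖪_{θ₂}[t]` (the typed `WindowFactorisation`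
shape of card A; its hypothesis `0 < t` is not needed): for `θ₁, θ₂ > 1`, `f ∈ L²(−t, t)` and `x ∈ (−t, t)`,
`∫_{(−t,t)} K_{θ₁+θ₂}(x + y) f(y) dy = ∫_{(−t,x)} K_{θ₁}(x − v) · (∫_{(−t,t)} K_{θ₂}(v + y) f(y) dy) dv`. -/
theorem window_factorisation {θ₁ θ₂ t : ℝ} (h₁ : 1 < θ₁) (h₂ : 1 < θ₂)
    {f : ℝ → ℝ} (hf : MemLp f 2 (volume.restrict (Ioo (-t) t))) {x : ℝ} (hx : x ∈ Ioo (-t) t) :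
    ∫ y in Ioo (-t) t, limKernel (θ₁ + θ₂) (x + y) * f y =
      ∫ v in Ioo (-t) x, limKernel θ₁ (x - v) * ∫ y in Ioo (-t) t, limKernel θ₂ (v + y) * f y := by
  have hxt := hx.2
  have hxt' := hx.1
  -- Step 1: the kernel through the causal window, inside the `y`-integral
  have hstep : ∫ y in Ioo (-t) t, limKernel (θ₁ + θ₂) (x + y) * f y =
      ∫ y in Ioo (-t) t, ∫ v in Ioo (-t) x, limKernel θ₁ (x - v) * limKernel θ₂ (v + y) * f y := by
    refine setIntegral_congr_fun measurableSet_Ioo fun y hy => ?_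
    rw [limKernel_add_shift_eq_setIntegral h₁ h₂ hy.2 x, ← integral_mul_const]
  rw [hstep]
  -- Step 2: Fubini on `(−t,t) × (−t,x)`
  have hfi : Integrable f (volume.restrict (Ioo (-t) t)) := hf.integrable one_le_two
  obtain ⟨C₁, hC₁0, hC₁⟩ := exists_bound_limKernel h₁ (2 * t)
  obtain ⟨C₂, hC₂0, hC₂⟩ := exists_bound_limKernel h₂ (2 * t)
  set μ : Measure ℝ := volume.restrict (Ioo (-t) t) with hμ
  set ν : Measure ℝ := volume.restrict (Ioo (-t) x) with hν
  set G : ℝ → ℝ → ℝ := fun y v => limKernel θ₁ (x - v) * limKernel θ₂ (v + y) * f y with hG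
  have hGm : AEStronglyMeasurable (Function.uncurry G) (μ.prod ν) := by
    have hK : Continuous fun p : ℝ × ℝ => limKernel θ₁ (x - p.2) * limKernel θ₂ (p.2 + p.1) :=
      ((Suzuki2020_thm12_continuous h₁).comp (by fun_prop)).mul
        ((Suzuki2020_thm12_continuous h₂).comp (by fun_prop))
    exact hK.aestronglyMeasurable.mul hfi.aestronglyMeasurable.comp_fst
  have hae : ∀ᵐ p : ℝ × ℝ ∂(μ.prod ν), p ∈ Ioo (-t) t ×ˢ Ioo (-t) x := by
    rw [hμ, hν, Measure.prod_restrict]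
    exact ae_restrict_mem (measurableSet_Ioo.prod measurableSet_Ioo)
  have hGi : Integrable (Function.uncurry G) (μ.prod ν) := by
    have hmaj : Integrable (fun p : ℝ × ℝ => C₁ * C₂ * |f p.1| * (1 : ℝ)) (μ.prod ν) :=
      (hfi.abs.const_mul (C₁ * C₂)).mul_prod (integrable_const (1 : ℝ))
    refine hmaj.mono' hGm (hae.mono fun p hp => ?_)
    obtain ⟨y, v⟩ := p
    obtain ⟨⟨hy1, hy2⟩, hv1, hv2⟩ := hp
    have b1 : |limKernel θ₁ (x - v)| ≤ C₁ := hC₁ _ (abs_le.2 ⟨by linarith, by linarith⟩)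
    have b2 : |limKernel θ₂ (v + y)| ≤ C₂ := hC₂ _ (abs_le.2 ⟨by linarith, by linarith⟩)
    simp only [Function.uncurry_apply_pair, hG, Real.norm_eq_abs, abs_mul, mul_one]
    have := mul_le_mul b1 b2 (abs_nonneg _) hC₁0
    exact mul_le_mul_of_nonneg_right this (abs_nonneg _)
  have hswap := integral_integral_swap hGi
  simp only [hG] at hswap
  rw [hswap]
  refine integral_congr_ae (Eventually.of_forall fun v => ?_)
  simp only
  rw [← integral_const_mul]
  congr 1
  funext y
  ring

end Summit.RiemannHypothesis.RiemannHypothesis.Theorems.SuzukiKernelSemigroup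

end
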